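import Summits.PneNP.PneNP.Theorems.ChebyshevTracialDesignProfilePolynomial
import HarnessLib

/-!
# Cell pnp-psdrank, route `ChebyshevTracialDesign`: an exact design reads off the profile polynomial at the virtual level —
# the r = 1 degree-truncation theorem with EXPLICIT tail `B·√(P_D · μ · ν)`, for weighted and for 0/1 rectangles

Harmonic backbone of the crux `TracialDecayExp20` (stmt-PneNP-19878), brick 19 (prover g7; consequences of brick 18,
`…ProfilePolynomial.weighted_profile_polynomial`). For `n` even, `t = 2c'+1`, `2t + 2 ≤ n`, `D < t`:
* `value_eq_level_sums` — the value of any kernel `g(U,M)` against a multilevel weight `W = Σ_{c∈C} w_c·1[Q_c]/|Q_c|` is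
  `Σ_{c∈C} (w_c/|Q_c|)·(level-c sum of g)`;
* `weighted_value_truncation_explicit` — for an EXACT design of degree `D` (levels `C`, weights `w`, any `T ≤ t`, any variation bound),
  a test function `f` on the `t`-cuts with harmonic layer decomposition `p` and ANY weights `y` on the perfect matchings:
  `|Σ_U Σ_M W(U,M)·f(U)·y(M) + (1/|PM|)·Σ_M y(M)·Ẽ_M[f_{≤D}]| ≤ (Σ_{c∈C} |w_c|)·√(P_D·(‖f‖²/C(n,t))·(‖y‖²/|PM|))`,
  `P_D = Π_{i ≤ D/2} (2i+1)/(n−2i)` — the design prices `f ⊗ y` at minus the averaged Grigoriev pseudo-expectation of the low part, up to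
  an explicit, design-independent tail (brick 16 had the tail as an abstract spectral bound `Σ_c |w_c|/|Q_c|·√(Λ_c|X||Y|)`);
* `rectangle_profile_polynomial` — for every 0/1 rectangle `X × Y`: ONE polynomial `P` of degree `≤ D` with
  `|#{(U,M) ∈ X × Y : cc(U,M) = c} − |Q_c|·P(c)| ≤ |Q_c|·√(P_D·μ(X)·ν(Y))` at EVERY odd level `c ≤ t` and
  `P(0) = (1/|PM|)·Σ_{M∈Y} Ẽ_M[(1_X)_{≤D}]`;
* `rectangle_value_truncation_explicit` — `|V(X × Y) + (1/|PM|)·Σ_{M∈Y} Ẽ_M[(1_X)_{≤D}]| ≤ B·√(P_D·μ(X)·ν(Y))` for every exact design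
  with `Σ|w_c| ≤ B`.
So the r = 1 shadow of the crux (`V(X × Y) ≤ e^{−a·dq n}` on tight rectangles, for the balanced Chebyshev designs) is EQUIVALENT up to
`20·√(P_{dq n} μν) = e^{−Ω(n^{1/4} log n)}` to `P(0) ≥ −e^{−a dq n}` for the profile polynomial `P` of the tight rectangle — a statement
about the rectangle alone, in which the design no longer appears. [cite: Rothvoss2017, §2 (PDF p. 6)]
[cite: Grigoriev2001, Lemma 1.4 (PDF p. 8)] [cite: BrouwerHaemers2012, Prop. 4.3.2 (PDF p. 83)]
Stature: support/instrument. WHAT THIS IS NOT: not virtual positivity, not the r = 1 rung, nothing on psd rank, no P-vs-NP content.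
Supports stmt-PneNP-19878.
-/

set_option linter.dupNamespace false -- `Summit.PneNP.PneNP.…`: summit = sub-problem (D-0017)

noncomputable section

namespace Summit.PneNP.PneNP.Theorems.ChebyshevTracialDesignProfileExtrapolation

open Finset Polynomial Literature.Barriers.PneNP Literature.Combinatorics.Optimization Literature.Computability.Complexity
open Literature.Combinatorics.AssociationSchemes Literature.Combinatorics.AssociationSchemes.JohnsonHarmonics
open Literature.Combinatorics.AssociationSchemes.JohnsonSpectrum
open Summit.PneNP.PneNP.Theorems.ChebyshevTracialDesignHighPartTail
open Summit.PneNP.PneNP.Theorems.ChebyshevTracialDesignLevelTail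
open Summit.PneNP.PneNP.Theorems.ChebyshevTracialDesignProfilePolynomial

variable {n : ℕ}

/-! ### §1 The value against a multilevel weight as a combination of level sums -/

/-- **Value = weighted level sums**: for any kernel `g` on (odd cuts) × (perfect matchings),
`Σ_U Σ_M levelWeight(U,M)·g(U,M) = Σ_{c∈C} (w_c/|Q_c(t)|)·Σ_M Σ_{|U| = t, cc(U,M) = c} g(U,M)`. [cite: Rothvoss2017, §2 (PDF p. 6, eq. (2))] -/
theorem value_eq_level_sums (t : ℕ) (C : Finset ℕ) (w : ℕ → ℝ) (g : OddSet n → PMatch n → ℝ) :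
    ∑ U : OddSet n, ∑ M : PMatch n, levelWeight n t C w U M * g U M =
      ∑ c ∈ C, w c / ((Qset n t c).card : ℝ) *
        ∑ M : PMatch n, ∑ U : OddSet n, (if U.1.card = t ∧ cc U M = c then g U M else 0) := by
  classical
  calc ∑ U : OddSet n, ∑ M : PMatch n, levelWeight n t C w U M * g U M
      = ∑ U : OddSet n, ∑ M : PMatch n, ∑ c ∈ C, (if (U, M) ∈ Qset n t c then
          w c / ((Qset n t c).card : ℝ) * g U M else 0) := by
        refine sum_congr rfl fun U _ => sum_congr rfl fun M _ => ?_
        rw [levelWeight, sum_mul]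
        exact sum_congr rfl fun c _ => by split_ifs <;> simp
    _ = ∑ U : OddSet n, ∑ c ∈ C, ∑ M : PMatch n, (if (U, M) ∈ Qset n t c then
          w c / ((Qset n t c).card : ℝ) * g U M else 0) := sum_congr rfl fun U _ => sum_comm
    _ = ∑ c ∈ C, ∑ U : OddSet n, ∑ M : PMatch n, (if (U, M) ∈ Qset n t c then
          w c / ((Qset n t c).card : ℝ) * g U M else 0) := sum_comm
    _ = ∑ c ∈ C, w c / ((Qset n t c).card : ℝ) *
          ∑ M : PMatch n, ∑ U : OddSet n, (if U.1.card = t ∧ cc U M = c then g U M else 0) := by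
        refine sum_congr rfl fun c _ => ?_
        rw [mul_sum, sum_comm]
        refine sum_congr rfl fun M _ => ?_
        rw [mul_sum]
        refine sum_congr rfl fun U _ => ?_
        simp only [mem_Qset_iff]
        split_ifs <;> simp

/-- The level-`c` sum of a product kernel `f(U)·y(M)` in incidence form: `Σ_M Σ_{|U|=t, cc = c} f(U) y(M) = Σ_M y(M)·Σ_{|U|=t} f(U)·1[#cr(U,M) = c]`
(`t` odd). -/
theorem level_sum_product_eq {t : ℕ} (ht : Odd t) (c : ℕ) (f : Finset (Fin n) → ℝ) (y : PMatch n → ℝ) :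
    ∑ M : PMatch n, ∑ U : OddSet n, (if U.1.card = t ∧ cc U M = c then f U.1 * y M else 0) =
      ∑ M : PMatch n, y M * ∑ U ∈ univ.powersetCard t,
        f U * (if (U.filter fun x => M.2.partner x ∉ U).card = c then (1 : ℝ) else 0) := by
  refine sum_congr rfl fun M _ => ?_
  rw [← sum_oddSet_level_eq_colSum ht M c f, mul_sum]
  exact sum_congr rfl fun U _ => by split_ifs <;> ring

/-- Sums against a `0/1` indicator over a finite type collapse to the indicated set. -/
theorem sum_boole_mul_univ {α : Type*} [Fintype α] [DecidableEq α] (Y : Finset α) (E : α → ℝ) :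
    ∑ a, (if a ∈ Y then (1 : ℝ) else 0) * E a = ∑ a ∈ Y, E a := by
  rw [← Finset.sum_filter_add_sum_filter_not univ (fun a => a ∈ Y)]
  have h1 : ∑ a ∈ univ.filter (fun a => a ∈ Y), (if a ∈ Y then (1 : ℝ) else 0) * E a = ∑ a ∈ Y, E a := by
    rw [filter_mem_eq_inter, univ_inter]
    exact sum_congr rfl fun a ha => by rw [if_pos ha, one_mul]
  have h2 : ∑ a ∈ univ.filter (fun a => ¬ a ∈ Y), (if a ∈ Y then (1 : ℝ) else 0) * E a = 0 :=
    sum_eq_zero fun a ha => by rw [if_neg (mem_filter.1 ha).2, zero_mul]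
  rw [h1, h2, add_zero]

/-- Sums against a `0/1` indicator of a subfamily collapse to the subfamily. -/
theorem sum_boole_mul_of_subset {α : Type*} [DecidableEq α] {s X : Finset α} (hX : X ⊆ s) (E : α → ℝ) :
    ∑ a ∈ s, (if a ∈ X then (1 : ℝ) else 0) * E a = ∑ a ∈ X, E a := by
  rw [← Finset.sum_filter_add_sum_filter_not s (fun a => a ∈ X)]
  have h1 : ∑ a ∈ s.filter (fun a => a ∈ X), (if a ∈ X then (1 : ℝ) else 0) * E a = ∑ a ∈ X, E a := by
    rw [filter_mem_eq_inter, inter_eq_right.2 hX]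
    exact sum_congr rfl fun a ha => by rw [if_pos ha, one_mul]
  have h2 : ∑ a ∈ s.filter (fun a => ¬ a ∈ X), (if a ∈ X then (1 : ℝ) else 0) * E a = 0 :=
    sum_eq_zero fun a ha => by rw [if_neg (mem_filter.1 ha).2, zero_mul]
  rw [h1, h2, add_zero]

/-- The squared `0/1` indicator of a subfamily sums to its size. -/
theorem sum_boole_sq_of_subset {α : Type*} [DecidableEq α] {s X : Finset α} (hX : X ⊆ s) :
    ∑ a ∈ s, (if a ∈ X then (1 : ℝ) else 0) ^ 2 = (X.card : ℝ) := by
  have h : ∀ a, (if a ∈ X then (1 : ℝ) else 0) ^ 2 = (if a ∈ X then (1 : ℝ) else 0) * 1 := fun a => by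
    split_ifs <;> simp
  rw [sum_congr rfl fun a _ => h a, sum_boole_mul_of_subset hX, sum_const, nsmul_eq_mul, mul_one]

/-! ### §2 The explicit-tail truncation theorem for weighted rectangles -/

/-- **The r = 1 degree-truncation theorem with explicit tail (weighted form).** For `n` even, an exact design
`(n, t = 2c'+1, T, D, B, C, w)` with `D < t`, a test function `f` on the `t`-cuts with harmonic layer decomposition `p`
(`f(U) = (Σ_j (Wᵀ)^{t−j} p_j)(U)` for `|U| = t`; `q = Σ_j (t−j)!·[j ≤ D]·p_j`) and ANY weights `y : PM_n → ℝ`: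
`|Σ_U Σ_M levelWeight(U,M)·f(U)·y(M) + (1/|PM|)·Σ_M y(M)·Σ_{|A|≤D} q_A·knapsackMoment(|M|, t/2, |M[A]|)|`
`≤ (Σ_{c∈C} |w_c|) · √(P_D · (Σ_{|U|=t} f(U)²/C(n,t)) · (Σ_M y(M)²/|PM|))`, `P_D = Π_{i<D/2+1} (2i+1)/(n−2i)`.
[cite: Rothvoss2017, §2 (PDF p. 6)] [cite: Grigoriev2001, Lemma 1.4 (PDF p. 8)] [cite: BrouwerHaemers2012, Prop. 4.3.2 (PDF p. 83)] -/
theorem weighted_value_truncation_explicit {c' T D : ℕ} {Bv : ℝ} {C : Finset ℕ} {w : ℕ → ℝ} (hn : Even n)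
    (hdes : IsExactDesign n (2 * c' + 1) T D Bv C w) (hD : D ≤ 2 * c')
    (f : Finset (Fin n) → ℝ) (p : ℕ → Finset (Fin n) → ℝ) (hp : ∀ j, IsHarmonic j (p j))
    (hdec : ∀ U ∈ univ.powersetCard (2 * c' + 1), f U = (∑ j ∈ range (2 * c' + 1 + 1), up^[2 * c' + 1 - j] (p j)) U)
    (y : PMatch n → ℝ) :
    |∑ U : OddSet n, ∑ M : PMatch n, levelWeight n (2 * c' + 1) C w U M * (f U.1 * y M) +
        (Fintype.card (PMatch n) : ℝ)⁻¹ * ∑ M : PMatch n, y M *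
          ∑ A : {A : Finset (Fin n) // A.card ≤ D},
            (∑ j ∈ range (2 * c' + 1 + 1), ((2 * c' + 1 - j).factorial : ℝ) • (if D < j then 0 else p j)) A.1 *
              knapsackMoment M.1.card (((2 * c' + 1 : ℕ) : ℝ) / 2) (M.1.filter fun e => ∃ a ∈ A.1, a ∈ e).card| ≤
      (∑ c ∈ C, |w c|) *
        Real.sqrt ((∏ i ∈ range (D / 2 + 1), ((2 * i + 1 : ℝ) / ((n : ℝ) - 2 * i))) *
          ((∑ U ∈ univ.powersetCard (2 * c' + 1), f U ^ 2) / (n.choose (2 * c' + 1) : ℝ)) *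
          ((∑ M : PMatch n, y M ^ 2) / (Fintype.card (PMatch n) : ℝ))) := by
  classical
  have ht : 2 * (2 * c' + 1) + 2 ≤ n := hdes.2.1
  have hTt : T ≤ 2 * c' + 1 := hdes.2.2.1
  have hC := hdes.2.2.2.1
  have hexact := hdes.2.2.2.2.2.1
  obtain ⟨P, hPdeg, hP0, hPlev⟩ := weighted_profile_polynomial hn ht hD f p hp hdec y
  set τ : ℝ := Real.sqrt ((∏ i ∈ range (D / 2 + 1), ((2 * i + 1 : ℝ) / ((n : ℝ) - 2 * i))) *
    ((∑ U ∈ univ.powersetCard (2 * c' + 1), f U ^ 2) / (n.choose (2 * c' + 1) : ℝ)) *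
    ((∑ M : PMatch n, y M ^ 2) / (Fintype.card (PMatch n) : ℝ))) with hτ
  -- the level sums `L_c` and their polynomial shadows
  set L : ℕ → ℝ := fun c => ∑ M : PMatch n, y M * ∑ U ∈ univ.powersetCard (2 * c' + 1),
    f U * (if (U.filter fun x => M.2.partner x ∉ U).card = c then (1 : ℝ) else 0) with hL
  have hval : ∑ U : OddSet n, ∑ M : PMatch n, levelWeight n (2 * c' + 1) C w U M * (f U.1 * y M) =
      ∑ c ∈ C, w c / ((Qset n (2 * c' + 1) c).card : ℝ) * L c := by
    rw [value_eq_level_sums]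
    exact sum_congr rfl fun c _ => by rw [level_sum_product_eq ⟨c', rfl⟩ c f y]
  -- per design level: `L_c = |Q_c|·P(c) + E_c`, `|E_c| ≤ |Q_c|·τ`, `|Q_c| > 0`
  have hlev : ∀ c ∈ C, |w c / ((Qset n (2 * c' + 1) c).card : ℝ) * L c - w c * P.eval (c : ℝ)| ≤ |w c| * τ := by
    intro c hc
    obtain ⟨⟨m, hm⟩, -, hcT, hne⟩ := hC c hc
    have hmc : m ≤ c' := by omega
    have hQpos : (0 : ℝ) < ((Qset n (2 * c' + 1) c).card : ℝ) := by exact_mod_cast card_pos.2 hne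
    have h1 : |L c - ((Qset n (2 * c' + 1) c).card : ℝ) * P.eval (c : ℝ)| ≤ ((Qset n (2 * c' + 1) c).card : ℝ) * τ := by
      have h0 := hPlev m hmc
      rw [← hm] at h0
      simpa only [hL] using h0
    have heq : w c / ((Qset n (2 * c' + 1) c).card : ℝ) * L c - w c * P.eval (c : ℝ) =
        w c / ((Qset n (2 * c' + 1) c).card : ℝ) * (L c - ((Qset n (2 * c' + 1) c).card : ℝ) * P.eval (c : ℝ)) := by
      field_simp
    rw [heq, abs_mul, abs_div, Nat.abs_cast]
    calc |w c| / ((Qset n (2 * c' + 1) c).card : ℝ) * |L c - ((Qset n (2 * c' + 1) c).card : ℝ) * P.eval (c : ℝ)|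
        ≤ |w c| / ((Qset n (2 * c' + 1) c).card : ℝ) * (((Qset n (2 * c' + 1) c).card : ℝ) * τ) :=
          mul_le_mul_of_nonneg_left h1 (div_nonneg (abs_nonneg _) hQpos.le)
      _ = |w c| * τ := by field_simp
  -- sum over the design levels and use exactness `Σ_c w_c P(c) = −P(0)`
  have hsum : ∑ U : OddSet n, ∑ M : PMatch n, levelWeight n (2 * c' + 1) C w U M * (f U.1 * y M) + P.eval 0 =
      ∑ c ∈ C, (w c / ((Qset n (2 * c' + 1) c).card : ℝ) * L c - w c * P.eval (c : ℝ)) := by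
    rw [hval, sum_sub_distrib, hexact P hPdeg]
    ring
  rw [← hP0, hsum, sum_mul]
  exact (abs_sum_le_sum_abs _ _).trans (sum_le_sum hlev)

/-! ### §3 0/1 rectangles: the level counts are a polynomial of the level -/

/-- **The profile polynomial of a rectangle.** For `n` even, `t = 2c'+1` with `2t + 2 ≤ n`, `D < t`, a family `X` of `t`-subsets with
harmonic layer decomposition `p` of its indicator (`1[U ∈ X] = (Σ_j (Wᵀ)^{t−j} p_j)(U)` on the `t`-sets; `q = Σ_j (t−j)!·[j ≤ D]·p_j`)
and any set `Y` of perfect matchings, there is a real polynomial `P` of degree `≤ D` with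
`P(0) = (1/|PM|)·Σ_{M∈Y} Σ_{|A|≤D} q_A·knapsackMoment(|M|, t/2, |M[A]|)` (the averaged Grigoriev pseudo-expectation of `(1_X)_{≤D}`) and,
at EVERY odd level `c = 2m+1 ≤ t`,
`|#{(U, M) ∈ X × Y : #cr(U,M) = c} − |Q_c(t)|·P(c)| ≤ |Q_c(t)| · √(P_D · (|X|/C(n,t)) · (|Y|/|PM|))`.
[cite: Rothvoss2017, §2 (PDF p. 6)] [cite: Grigoriev2001, Lemma 1.4 (PDF p. 8)] [cite: BrouwerHaemers2012, Prop. 4.3.2 (PDF p. 83)] -/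
theorem rectangle_profile_polynomial {c' D : ℕ} (hn : Even n) (ht : 2 * (2 * c' + 1) + 2 ≤ n) (hD : D ≤ 2 * c')
    (X : Finset (Finset (Fin n))) (hX : X ⊆ univ.powersetCard (2 * c' + 1)) (Y : Finset (PMatch n))
    (p : ℕ → Finset (Fin n) → ℝ) (hp : ∀ j, IsHarmonic j (p j))
    (hdec : ∀ U ∈ univ.powersetCard (2 * c' + 1),
      (if U ∈ X then (1 : ℝ) else 0) = (∑ j ∈ range (2 * c' + 1 + 1), up^[2 * c' + 1 - j] (p j)) U) :
    ∃ P : Polynomial ℝ, P.natDegree ≤ D ∧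
      P.eval 0 = (Fintype.card (PMatch n) : ℝ)⁻¹ * ∑ M ∈ Y,
        ∑ A : {A : Finset (Fin n) // A.card ≤ D},
          (∑ j ∈ range (2 * c' + 1 + 1), ((2 * c' + 1 - j).factorial : ℝ) • (if D < j then 0 else p j)) A.1 *
            knapsackMoment M.1.card (((2 * c' + 1 : ℕ) : ℝ) / 2) (M.1.filter fun e => ∃ a ∈ A.1, a ∈ e).card ∧
      ∀ m : ℕ, m ≤ c' →
        |((((X ×ˢ Y).filter fun UM : Finset (Fin n) × PMatch n =>
              (UM.1.filter fun x => UM.2.2.partner x ∉ UM.1).card = 2 * m + 1).card : ℕ) : ℝ) -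
            ((Qset n (2 * c' + 1) (2 * m + 1)).card : ℝ) * P.eval ((2 * m + 1 : ℕ) : ℝ)| ≤
          ((Qset n (2 * c' + 1) (2 * m + 1)).card : ℝ) *
            Real.sqrt ((∏ i ∈ range (D / 2 + 1), ((2 * i + 1 : ℝ) / ((n : ℝ) - 2 * i))) *
              ((X.card : ℝ) / (n.choose (2 * c' + 1) : ℝ)) * ((Y.card : ℝ) / (Fintype.card (PMatch n) : ℝ))) := by
  classical
  obtain ⟨P, hPdeg, hP0, hPlev⟩ := weighted_profile_polynomial hn ht hD (fun U => if U ∈ X then (1 : ℝ) else 0) p hp hdec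
    (fun M => if M ∈ Y then (1 : ℝ) else 0)
  refine ⟨P, hPdeg, ?_, fun m hmc => ?_⟩
  · rw [hP0, sum_boole_mul_univ Y]
  · have h1 := hPlev m hmc
    -- `Σ 1_X² = |X|`, `Σ 1_Y² = |Y|`
    have hfX : ∑ U ∈ univ.powersetCard (2 * c' + 1), (if U ∈ X then (1 : ℝ) else 0) ^ 2 = (X.card : ℝ) :=
      sum_boole_sq_of_subset hX
    have hfY : ∑ M : PMatch n, (if M ∈ Y then (1 : ℝ) else 0) ^ 2 = (Y.card : ℝ) :=
      sum_boole_sq_of_subset (subset_univ Y)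
    -- the weighted level sum is the level count of the rectangle
    have hL : ∑ M : PMatch n, (if M ∈ Y then (1 : ℝ) else 0) * ∑ U ∈ univ.powersetCard (2 * c' + 1),
          (if U ∈ X then (1 : ℝ) else 0) * (if (U.filter fun x => M.2.partner x ∉ U).card = 2 * m + 1 then (1 : ℝ) else 0) =
        ∑ M ∈ Y, ∑ U ∈ X, (if (U.filter fun x => M.2.partner x ∉ U).card = 2 * m + 1 then (1 : ℝ) else 0) := by
      rw [sum_boole_mul_univ Y]
      exact sum_congr rfl fun M _ => sum_boole_mul_of_subset hX _
    have hR : ((((X ×ˢ Y).filter fun UM : Finset (Fin n) × PMatch n =>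
            (UM.1.filter fun x => UM.2.2.partner x ∉ UM.1).card = 2 * m + 1).card : ℕ) : ℝ) =
        ∑ M ∈ Y, ∑ U ∈ X, (if (U.filter fun x => M.2.partner x ∉ U).card = 2 * m + 1 then (1 : ℝ) else 0) := by
      rw [card_filter, Nat.cast_sum, sum_product, sum_comm]
      push_cast
      rfl
    rw [hfX, hfY, hL, ← hR] at h1
    exact h1

/-- **The r = 1 degree-truncation theorem with explicit tail (0/1 rectangles).** For `n` even, an exact design
`(n, t = 2c'+1, T, D, B, C, w)` with `D < t`, a family `X` of `t`-subsets with harmonic layer decomposition `p` of its indicator and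
any set `Y` of perfect matchings:
`|Σ_U Σ_{M∈Y} levelWeight(U,M)·1_X(U) + (1/|PM|)·Σ_{M∈Y} Ẽ_M[(1_X)_{≤D}]| ≤ B · √(P_D · (|X|/C(n,t)) · (|Y|/|PM|))`, `P_D = Π_{i<D/2+1} (2i+1)/(n−2i)`:
the design value of the rectangle is minus the averaged Grigoriev pseudo-expectation of the truncated indicator, up to `B√(P_D μ ν)`.
[cite: Rothvoss2017, §2 (PDF p. 6)] [cite: Grigoriev2001, Lemma 1.4 (PDF p. 8)] [cite: CoppersmithRivlin1992, Thm. (p. 970)] -/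
theorem rectangle_value_truncation_explicit {c' T D : ℕ} {Bv : ℝ} {C : Finset ℕ} {w : ℕ → ℝ} (hn : Even n)
    (hdes : IsExactDesign n (2 * c' + 1) T D Bv C w) (hD : D ≤ 2 * c')
    (X : Finset (Finset (Fin n))) (hX : X ⊆ univ.powersetCard (2 * c' + 1)) (Y : Finset (PMatch n))
    (p : ℕ → Finset (Fin n) → ℝ) (hp : ∀ j, IsHarmonic j (p j))
    (hdec : ∀ U ∈ univ.powersetCard (2 * c' + 1),
      (if U ∈ X then (1 : ℝ) else 0) = (∑ j ∈ range (2 * c' + 1 + 1), up^[2 * c' + 1 - j] (p j)) U) :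
    |∑ U : OddSet n, ∑ M ∈ Y, levelWeight n (2 * c' + 1) C w U M * (if U.1 ∈ X then (1 : ℝ) else 0) +
        (Fintype.card (PMatch n) : ℝ)⁻¹ * ∑ M ∈ Y,
          ∑ A : {A : Finset (Fin n) // A.card ≤ D},
            (∑ j ∈ range (2 * c' + 1 + 1), ((2 * c' + 1 - j).factorial : ℝ) • (if D < j then 0 else p j)) A.1 *
              knapsackMoment M.1.card (((2 * c' + 1 : ℕ) : ℝ) / 2) (M.1.filter fun e => ∃ a ∈ A.1, a ∈ e).card| ≤
      Bv * Real.sqrt ((∏ i ∈ range (D / 2 + 1), ((2 * i + 1 : ℝ) / ((n : ℝ) - 2 * i))) *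
        ((X.card : ℝ) / (n.choose (2 * c' + 1) : ℝ)) * ((Y.card : ℝ) / (Fintype.card (PMatch n) : ℝ))) := by
  classical
  have hB := hdes.2.2.2.2.2.2
  have h := weighted_value_truncation_explicit hn hdes hD (fun U => if U ∈ X then (1 : ℝ) else 0) p hp hdec
    (fun M => if M ∈ Y then (1 : ℝ) else 0)
  -- identify the three sums
  have hfX : ∑ U ∈ univ.powersetCard (2 * c' + 1), (if U ∈ X then (1 : ℝ) else 0) ^ 2 = (X.card : ℝ) :=
    sum_boole_sq_of_subset hX
  have hfY : ∑ M : PMatch n, (if M ∈ Y then (1 : ℝ) else 0) ^ 2 = (Y.card : ℝ) :=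
    sum_boole_sq_of_subset (subset_univ Y)
  have hV : ∑ U : OddSet n, ∑ M : PMatch n, levelWeight n (2 * c' + 1) C w U M *
        ((if U.1 ∈ X then (1 : ℝ) else 0) * (if M ∈ Y then (1 : ℝ) else 0)) =
      ∑ U : OddSet n, ∑ M ∈ Y, levelWeight n (2 * c' + 1) C w U M * (if U.1 ∈ X then (1 : ℝ) else 0) := by
    refine sum_congr rfl fun U _ => ?_
    rw [← sum_boole_mul_univ Y]
    exact sum_congr rfl fun M _ => by ring
  have hE : ∑ M : PMatch n, (if M ∈ Y then (1 : ℝ) else 0) *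
        ∑ A : {A : Finset (Fin n) // A.card ≤ D},
          (∑ j ∈ range (2 * c' + 1 + 1), ((2 * c' + 1 - j).factorial : ℝ) • (if D < j then 0 else p j)) A.1 *
            knapsackMoment M.1.card (((2 * c' + 1 : ℕ) : ℝ) / 2) (M.1.filter fun e => ∃ a ∈ A.1, a ∈ e).card =
      ∑ M ∈ Y, ∑ A : {A : Finset (Fin n) // A.card ≤ D},
          (∑ j ∈ range (2 * c' + 1 + 1), ((2 * c' + 1 - j).factorial : ℝ) • (if D < j then 0 else p j)) A.1 *
            knapsackMoment M.1.card (((2 * c' + 1 : ℕ) : ℝ) / 2) (M.1.filter fun e => ∃ a ∈ A.1, a ∈ e).card :=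
    sum_boole_mul_univ Y _
  rw [hV, hE, hfX, hfY] at h
  refine h.trans (mul_le_mul_of_nonneg_right hB (Real.sqrt_nonneg _))

end Summit.PneNP.PneNP.Theorems.ChebyshevTracialDesignProfileExtrapolation
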